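import Mathlib
import Summits.ValiantsHypothesis.ValiantsHypothesis.Theorems.DivisionGapPerMultiplesHardOrderedFactor
import Summits.ValiantsHypothesis.ValiantsHypothesis.Theorems.DivisionGapPerMultiplesHardRichHostOfSquareBlock

/-!
# `DivisionGap.PerMultiplesHard` (stmt-ValiantsHypothesis-5068), line `uncharged-face-walk`:
the ORDERED FACTOR, part 5 of 5 — rich host + complete class + a QUASI-RANDOM σ-square block ⇒ hard (lead c8, cycle 8)

`richHost_of_quasiRandomBlock`: the tree's `richHost_of_squareBlock` (p134108: block-slice descent + small-window jaw on
a regular comparison host) with its `f`-factor hypothesis replaced by the QUASI-RANDOMNESS data of the block — the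
hypotheses of `stub_orderedFactor` (part 4): minimum degrees `a/D₁`, typical codegree `c₂ ∈ [a/D₂, a]` and 4-wise level `c₄`
with `D₃`-small `ℓ¹` deviations, at most `a/E` low-codegree partners per row.  The order `ρ` from `stub_orderedFactor`
re-enumerates the rows (`ρ.trans eA`), and the `f`-regular `Y'` inside the shifted intersection is exactly the datum
`richHost_of_squareBlock` consumes.  So the rich-host complete-class rung of the skeleton (`richHostCompleteClassHard`)
is a theorem modulo the EXTRACTION of such a block alone (`stub_quasiRandomSquareBlock`). Elementary. [folklore]
-/

noncomputable section

-- `Summit.ValiantsHypothesis.ValiantsHypothesis.…` is the tree's mandated layout (Sub = Summit).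
set_option linter.dupNamespace false

open Finset
open scoped BigOperators

namespace Summit.ValiantsHypothesis.ValiantsHypothesis.Theorems.DivisionGap.PerMultiplesHard.OrderedFactor

variable {a : ℕ}

/-! ### The rich-host complete-class rung from a QUASI-RANDOM σ-square block -/

section RichHost
open MvPolynomial Literature.Computability.AlgebraicComplexity
open scoped NNReal

/-- **Rich host + complete class + a quasi-random σ-square block ⇒ hard (lead c8).**  The tree's `richHost_of_squareBlock`
(p134108) with its `f`-factor hypothesis replaced by the QUASI-RANDOMNESS data of the block (the hypotheses of
`orderedFactor`): for all `D₁, D₂, Cb ≥ 1` there are `D₃, E, d, n₀` such that for `n ≥ n₀`, a host `G`, `t` torus-homogeneous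
with margins `(R, C)` COMPLETE on `G` with some table, margins balanced, `n`-close and of offset `≥ 3n³`, and a block-diagonal
matching `σ ⊆ G` carrying a block `A × B` of size `a ≥ n/Cb` whose transported host `X` has minimum degrees `a/D₁`, typical
codegree `c₂ ∈ [a/D₂, a]` and 4-wise level `c₄` with `D₃`-small deviations and at most `a/E` low-codegree partners per row:
`2^{⌊n/d⌋} ≤ L⁺(per_G · t)`. [folklore] -/
theorem richHost_of_quasiRandomBlock :
    ∀ D₁ D₂ Cb : ℕ, 1 ≤ D₁ → 1 ≤ D₂ → 1 ≤ Cb → ∃ D₃ E d n₀ : ℕ, 1 ≤ D₃ ∧ 1 ≤ E ∧ ∀ n ≥ n₀, ∀ (G : Finset (Fin n × Fin n))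
      (t : MvPolynomial (Fin n × Fin n) ℝ≥0) (R C : Fin n → ℕ),
      (∀ m ∈ t.support, (∀ i, ∑ j, m (i, j) = R i) ∧ (∀ j, ∑ i, m (i, j) = C j)) →
      (∀ M : (Fin n × Fin n) →₀ ℕ, M.support ⊆ G →
        (∀ i, ∑ j, M (i, j) = R i) → (∀ j, ∑ i, M (i, j) = C j) → M ∈ t.support) →
      (∃ M : (Fin n × Fin n) →₀ ℕ, M.support ⊆ G ∧ (∀ i, ∑ j, M (i, j) = R i) ∧ (∀ j, ∑ i, M (i, j) = C j)) →
      ∑ i, R i = ∑ j, C j →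
      (∀ i j, R i ≤ C j + n ∧ C j ≤ R i + n) →
      (∀ i, 3 * n ^ 3 ≤ R i) →
      ∀ (a : ℕ) (A B : Finset (Fin n)) (eA : Fin a ≃ {x // x ∈ A}) (eB : Fin a ≃ {x // x ∈ B})
        (σ : Equiv.Perm (Fin n)) (X : Finset (Fin a × Fin a)) (c₂ c₄ : ℕ),
        n ≤ Cb * a → (∀ i, (σ i, i) ∈ G) → (∀ i, σ i ∈ A ↔ i ∈ B) →
        (∀ e : Fin a × Fin a, e ∈ X ↔ ((eA e.1 : Fin n), (eB e.2 : Fin n)) ∈ G) →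
        (∀ x : Fin a, a ≤ D₁ * (Finset.univ.filter fun y : Fin a => (x, y) ∈ X).card) →
        (∀ y : Fin a, a ≤ D₁ * (Finset.univ.filter fun x : Fin a => (x, y) ∈ X).card) →
        a ≤ D₂ * c₂ → c₂ ≤ a →
        (D₃ : ℝ) * (∑ x : Fin a, ∑ x' ∈ Finset.univ.erase x,
            |(((Finset.univ.filter fun y : Fin a => (x, y) ∈ X ∧ (x', y) ∈ X).card : ℕ) : ℝ) - c₂|) ≤ (a : ℝ) ^ 3 →
        (D₃ : ℝ) * (∑ x₁ : Fin a, ∑ x₂ ∈ Finset.univ.erase x₁, ∑ x₃ ∈ (Finset.univ.erase x₁).erase x₂,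
            ∑ x₄ ∈ ((Finset.univ.erase x₁).erase x₂).erase x₃,
            |(((Finset.univ.filter fun y : Fin a =>
                (x₁, y) ∈ X ∧ (x₂, y) ∈ X ∧ (x₃, y) ∈ X ∧ (x₄, y) ∈ X).card : ℕ) : ℝ) - c₄|) ≤ (a : ℝ) ^ 5 →
        (D₃ : ℝ) * |(c₄ : ℝ) * a - (c₂ : ℝ) ^ 2| ≤ (a : ℝ) ^ 2 →
        (∀ x : Fin a, E * (Finset.univ.filter fun y : Fin a => y ≠ x ∧
            (Finset.univ.filter fun z : Fin a => (x, z) ∈ X ∧ (y, z) ∈ X).card < a / D₂).card ≤ a) →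
        2 ^ (n / d) ≤
          complexity ((∑ σ ∈ (Finset.univ : Finset (Equiv.Perm (Fin n))).filter (fun σ => ∀ i, (σ i, i) ∈ G),
            monomial (permMonomial σ) (1 : ℝ≥0)) * t) := by
  classical
  intro D₁ D₂ Cb hD₁ hD₂ hCb
  obtain ⟨D₃, E, Cf', a₀, hD₃, hE, hCf', hOF⟩ := stub_orderedFactor D₁ D₂ hD₁ hD₂
  obtain ⟨n₂, hmain⟩ :=
    RichHostOfSquareBlock.richHost_of_squareBlock
      (Cb * Cf') (le_trans hCb (Nat.le_mul_of_pos_right _ hCf'))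
  refine ⟨D₃, E, Cb * Cf' * (1024 * (Cb * Cf')), n₂ + Cb * a₀, hD₃, hE, ?_⟩
  intro n hn G t R C ht hcomp hex hbal hclose hoff a A B eA eB σ X c₂ c₄ hna hσG hσAB hXG hr hc hc₂ hc₂a hdev₂ hdev₄ hc₄ hbad
  have ha₀ : a₀ ≤ a := by
    by_contra h
    have h1 : Cb * a < Cb * a₀ := Nat.mul_lt_mul_of_pos_left (lt_of_not_ge h) hCb
    omega
  obtain ⟨ρ, Y', f, hf1, haf, hY'H, hYrow, hYcol⟩ := hOF a ha₀ X c₂ c₄ hr hc hc₂ hc₂a hdev₂ hdev₄ hc₄ hbad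
  have hna' : n ≤ Cb * Cf' * a := hna.trans (by rw [Nat.mul_assoc]; exact Nat.mul_le_mul_left _ (Nat.le_mul_of_pos_left _ hCf'))
  have haf' : a ≤ Cb * Cf' * f := haf.trans (by rw [Nat.mul_assoc]; exact Nat.le_mul_of_pos_left _ hCb)
  have hY' : ∀ e ∈ Y', (((ρ.trans eA) e.1 : Fin n), (eB e.2 : Fin n)) ∈ G ∧
      (((ρ.trans eA) ((finRotate a).symm e.1) : Fin n), (eB e.2 : Fin n)) ∈ G := by
    intro e he
    have hmem := (Finset.mem_filter.mp (hY'H he)).2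
    exact ⟨(hXG _).mp hmem.1, (hXG _).mp hmem.2⟩
  exact hmain n (by omega) G t R C ht hcomp hex hbal hclose hoff a A B (ρ.trans eA) eB σ Y' f hna' hσG hσAB hf1 haf'
    hY' hYrow hYcol

end RichHost

end Summit.ValiantsHypothesis.ValiantsHypothesis.Theorems.DivisionGap.PerMultiplesHard.OrderedFactor

end
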